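import Literature.NumberTheory.EllipticCurves.BigRepModuleFiniteCoeffDualProofs
import Literature.NumberTheory.EllipticCurves.BigRepModuleTotallySplitH1Proofs
import Literature.NumberTheory.EllipticCurves.IwasawaSelmerIsTorsionProofs
import Literature.NumberTheory.EllipticCurves.JetchevSkinnerWan2017.SigmaLocalCharIdeal
import Literature.NumberTheory.EllipticCurves.BigGaloisRepLocalInputs
import Literature.NumberTheory.GaloisRepresentations.HOneRestrictionOntoInvariantsFinite
import Literature.NumberTheory.GaloisRepresentations.AbsGaloisGroupCompact
import HarnessLib

/-!
# The local term of the `Σ`-change at a TOTALLY SPLIT place `w ∤ p` (`Ψ(Frob_w) = 1`), reduced to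
# the order of `H¹(K_w, E[p^∞])` — PROVED

Topic `Literature/NumberTheory/EllipticCurves/JetchevSkinnerWan2017` (sibling of the named LOCAL fact
`sigmaLocal_charIdeal_eulerFactor_mem_of_noTamagawaDefect`, file `SigmaLocalCharIdeal.lean`). THEOREMS
ONLY: no definition, no named fact, no instance, no `sorry`. Cell `bsd-stepL` (typer lane `defn-ty1`,
g9), module L3 of the discharge plan `HOME/defn-ty1/g9/NOTE-sigmaLocal-discharge-plan-defn-ty1-g9.md`.

At a place `w ∤ p` whose Euler datum has Frobenius exponent `c = κ(φ_w) = 0` ("totally split in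
`K_∞`": every `ℓ` inert or ramified in `K` for the anticyclotomic tower, [PollackWeston2011] Lemma 3.2;
[Brink2007] Thm. 2), the decomposition group `Γ_{K_w}` acts on `M = T_pE ⊗ Λ^*(Ψ⁻¹)` through
`ρ_{E,p^∞}` alone, and the Pontryagin dual of `H¹(K_w, M)` is `H¹(K_w, E[p^∞])^∨ ⊗ Λ`, a finitely
generated torsion `Λ`-module whose characteristic ideal contains (indeed equals) `(#H¹(K_w, E[p^∞]))`
([Castella2018] Thm. 2.3 (2.7): the factor "`∏_{w∈Σ} #H¹(K_w, E[p^∞])`").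

## What is proved

* `BigRepModule.moduleFinite_isTorsion_natCard_mem_charIdeal_h1_bigRep` (generic, modules L1 + L2):
  for a compact `D`, a TRIVIAL `κ : D → ℤ_p` and a continuous `ℤ_p`-linear `ρ` of `D` on a discrete
  `p`-primary `A` with `H¹(D, A)` finite, the Pontryagin dual of `H¹(D, bigRep κ ρ)` is a finitely
  generated torsion `Λ`-module with `#H¹(D, A) ∈ Ch_Λ` (transport of
  `BigRepModule.moduleFinite_isTorsion_natCard_mem_charIdeal` along the dual of
  `BigRepModule.exists_linearEquiv_h1_bigRep_of_forall_eq_one`);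
* `ContinuousMonoidHom.padicInt_apply_eq_one_of_isFrobPow` — for a non-archimedean local field `F` of
  residue characteristic `≠ p`, a continuous `χ : Γ_F → ℤ_p` trivial on ONE arithmetic Frobenius lift is
  trivial (it kills the inertia group — the tree's `apply_eq_one_of_mem_absInertia` — and a Frobenius
  topologically generates `Γ_F/I_F`, the tree's `dense_zpowers_mk_absInertia_of_isFrobPow`);
* `ZpExtension.apply_localMap_inl_eq_one_of_isFrobPow` / `…_of_isEulerDataAt` — for a `ℤ_p`-extension
  `κ` of the number field `K` and a place `w ∤ p` with Euler datum of exponent `c = 0`: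
  `κ ∘ localMap K (Sum.inl w) = 1` (the whole decomposition group at `w` fixes `K_∞`);
* **`moduleFinite_isTorsion_natCard_mem_charIdeal_of_isEulerDataAt_zero`** — hence (`bigRep_restrict`)
  the three conjuncts of the named local fact at such a `w` hold with `#H¹(K_w, E[p^∞])` IN PLACE OF the
  Euler factor `P_w`, as soon as `H¹(K_w, E[p^∞])` is finite.

HONEST FRAMING: this does NOT discharge the named fact at the totally split places: it remains to prove
(module L4) that `H¹(K_w, E[p^∞])` is finite of order dividing `P_w(Nw⁻¹)·(unit)` under
`NoTamagawaDefect` (local Euler characteristic and duality at `ℓ ≠ p`, `#E(K_w)[p^∞]` against the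
reduction type), and (L5) the finitely decomposed places.

References: [PollackWeston2011] Lemma 3.2; [Castella2018] Thm. 2.3 (2.7), Prop. 2.5; [Brink2007] Thm. 2;
[Washington1997] Prop. 13.2; [NeukirchSchmidtWingberg2008] Thm. 7.5.3; [JetchevSkinnerWan2017] §5.1 Remark
(inert places). Tree: `InertiaPadicCharacterProofs` (`apply_eq_one_of_mem_absInertia`),
`HOneRestrictionOntoInvariantsFinite` (`dense_zpowers_mk_absInertia_of_isFrobPow`),
`BigGaloisRepLocalInputs` (`ZpExtension.apply_localMap_inr`), `BigRepModuleFiniteCoeffDualProofs` (L1),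
`BigRepModuleTotallySplitH1Proofs` (L2), `IwasawaSelmerIsTorsionProofs` (`Module.charIdeal_eq_of_linearEquiv`).
-/

noncomputable section

open Multiplicative Topology Field IsDedekindDomain NumberField WeierstrassCurve
open Literature.NumberTheory.GaloisRepresentations Literature.NumberTheory.EllipticCurves
  Literature.NumberTheory.EllipticCurves.BigGaloisRep Literature.NumberTheory.EllipticCurves.IwasawaCharacter

universe u

/-! ## §0 The Pontryagin dual of `H¹(D, bigRep κ ρ)` for trivial `κ`: f.g., torsion, `#H¹(D, A) ∈ Ch` -/

namespace Literature.NumberTheory.EllipticCurves.BigRepModule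

variable {p : ℕ} [hp : Fact p.Prime] {A : Type u} [AddCommGroup A] [Module ℤ_[p] A]
  [TopologicalSpace A] [DiscreteTopology A] [ContinuousSMul ℤ_[p] A]
  {D : Type u} [Group D] [TopologicalSpace D] [IsTopologicalGroup D] [CompactSpace D]
  [TopologicalSpace (PowerSeries ℤ_[p])] [ContinuousSMul (PowerSeries ℤ_[p]) (BigRepModule ℤ_[p] p A)]
  (κ : D →ₜ* Multiplicative ℤ_[p]) (ρ : ContinuousRep D ℤ_[p] A)

/-- **The totally split local term** ([PollackWeston2011] Lemma 3.2 with [Castella2018] (2.7), in the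
tree's co-induced model): for a compact `D`, a TRIVIAL `κ`, and a continuous `ℤ_p`-linear `ρ` on a
discrete `p`-primary `A` with `H¹(D, A)` FINITE, the Pontryagin dual (Mathlib `CharacterModule`) of
`H¹(D, bigRep κ ρ)` is a finitely generated torsion `Λ = ℤ_p⟦T⟧`-module whose characteristic ideal
contains `#H¹(D, A)` (transport of module L1, `moduleFinite_isTorsion_natCard_mem_charIdeal`, along the
dual of `exists_linearEquiv_h1_bigRep_of_forall_eq_one`).
[cite: PollackWeston2011, Lemma 3.2] [cite: Castella2018, Thm. 2.3 (2.7) (the factor ∏_{w∈Σ} #H¹(K_w, E[p^∞]))]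
[cite: SkinnerUrban2014, §3.1.2 ((3.1.2.b))] -/
theorem moduleFinite_isTorsion_natCard_mem_charIdeal_h1_bigRep (hκ : ∀ d : D, κ d = 1)
    (hA : ∀ a : A, ∃ k : ℕ, p ^ k • a = 0) [Finite (continuousCohomology 1 ρ.toTopRep)] :
    Module.Finite (IwasawaAlgebra p) (CharacterModule (continuousCohomology 1 (bigRep κ ρ).toTopRep)) ∧
      Module.IsTorsion (IwasawaAlgebra p)
          (CharacterModule (continuousCohomology 1 (bigRep κ ρ).toTopRep)) ∧
        ((Nat.card (continuousCohomology 1 ρ.toTopRep) : ℕ) : IwasawaAlgebra p) ∈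
          Module.charIdeal (IwasawaAlgebra p)
            (CharacterModule (continuousCohomology 1 (bigRep κ ρ).toTopRep)) := by
  obtain ⟨e, -⟩ := exists_linearEquiv_h1_bigRep_of_forall_eq_one κ ρ hκ hA
  -- `H¹(D, A)` is `p`-primary (compact `D`, discrete `p`-primary `A`)
  have hpA : ∀ a : A, ∃ m : ℕ, (p : ℤ_[p]) ^ m • a = 0 := fun a ↦
    (hA a).imp fun m hm ↦ by rw [← Nat.cast_pow, Nat.cast_smul_eq_nsmul]; exact hm
  have hH : ∀ h : continuousCohomology 1 ρ.toTopRep, ∃ k : ℕ, p ^ k • h = 0 := fun h ↦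
    (BigGaloisRep.exists_pow_smul_eq_zero ρ.toTopRep (p : ℤ_[p]) hpA h).imp fun m hm ↦ by
      rwa [← Nat.cast_pow, Nat.cast_smul_eq_nsmul] at hm
  obtain ⟨hfg, htors, hch⟩ := moduleFinite_isTorsion_natCard_mem_charIdeal (p := p) hH
  -- transport along the dual of `e`
  let e' : CharacterModule (BigRepModule ℤ_[p] p (continuousCohomology 1 ρ.toTopRep)) ≃ₗ[IwasawaAlgebra p]
      CharacterModule (continuousCohomology 1 (bigRep κ ρ).toTopRep) := (CharacterModule.congr e).symm
  refine ⟨Module.Finite.equiv e', ?_, ?_⟩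
  · exact Literature.NumberTheory.EllipticCurves.isTorsion_of_surjective e'.toLinearMap e'.surjective htors
  · rw [← Module.charIdeal_eq_of_linearEquiv e']
    exact hch

end Literature.NumberTheory.EllipticCurves.BigRepModule

/-! ## §1 A `p`-adic character of `Γ_F` trivial on a Frobenius lift is trivial (`ℓ ≠ p`) -/

namespace Literature.NumberTheory.GaloisRepresentations

open IsNonarchimedeanLocalField ValuativeRel

variable {F : Type u} [Field F] [ValuativeRel F] [TopologicalSpace F] [IsNonarchimedeanLocalField F]
  {p : ℕ} [Fact p.Prime]

/-- **A continuous `χ : Γ_F → ℤ_p` with `χ(φ) = 1` for an arithmetic Frobenius lift `φ` is trivial**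
(`F` non-archimedean local of residue characteristic `≠ p`): `χ` kills the inertia group `I_F`
(`apply_eq_one_of_mem_absInertia`: `ℤ_p`-valued characters are unramified away from `p`), so it factors
through `Γ_F/I_F`, where the image of `φ` generates a dense subgroup
(`dense_zpowers_mk_absInertia_of_isFrobPow`) on which the (continuous) factored character vanishes.
[cite: Washington1997, Prop. 13.2 (ℤ_p-extensions are unramified outside p)]
[cite: NeukirchSchmidtWingberg2008, Thm. 7.5.3 (`Γ_F/I_F ≅ Ẑ` topologically generated by Frobenius)] -/
theorem ContinuousMonoidHom.padicInt_apply_eq_one_of_isFrobPow (hp : ringChar 𝓀[F] ≠ p)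
    (χ : absoluteGaloisGroup F →ₜ* Multiplicative ℤ_[p]) {φ : absoluteGaloisGroup F}
    (hφ : IsFrobPow φ 1) (hχφ : χ φ = 1) (σ : absoluteGaloisGroup F) : χ σ = 1 := by
  haveI : (absInertia F).Normal := absInertia_normal_holds F
  have hI : absInertia F ≤ χ.toMonoidHom.ker := fun τ hτ ↦ apply_eq_one_of_mem_absInertia hp χ hτ
  let χbar : absoluteGaloisGroup F ⧸ absInertia F →* Multiplicative ℤ_[p] :=
    QuotientGroup.lift (absInertia F) χ.toMonoidHom hI
  have hχbar : ∀ g : absoluteGaloisGroup F, χbar (QuotientGroup.mk g) = χ g := fun _ ↦ rfl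
  have hcont : Continuous χbar :=
    (QuotientGroup.isQuotientMap_mk (absInertia F)).continuous_iff.2 χ.continuous
  have hS : IsClosed {x : absoluteGaloisGroup F ⧸ absInertia F | χbar x = 1} :=
    isClosed_eq hcont continuous_const
  have hsub : ((Subgroup.zpowers (QuotientGroup.mk φ : absoluteGaloisGroup F ⧸ absInertia F) :
      Subgroup (absoluteGaloisGroup F ⧸ absInertia F)) : Set (absoluteGaloisGroup F ⧸ absInertia F)) ⊆
      {x | χbar x = 1} := by
    rintro _ ⟨n, rfl⟩
    change χbar ((QuotientGroup.mk φ : absoluteGaloisGroup F ⧸ absInertia F) ^ n) = 1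
    rw [map_zpow, hχbar, hχφ, one_zpow]
  have huniv : {x : absoluteGaloisGroup F ⧸ absInertia F | χbar x = 1} = Set.univ := by
    refine Set.eq_univ_of_univ_subset ?_
    rw [← (dense_zpowers_mk_absInertia_of_isFrobPow F hφ).closure_eq]
    exact hS.closure_subset_iff.2 hsub
  have hσ := Set.eq_univ_iff_forall.1 huniv (QuotientGroup.mk σ)
  rwa [Set.mem_setOf_eq, hχbar] at hσ

end Literature.NumberTheory.GaloisRepresentations

/-! ## §2 At a place with Frobenius exponent `c = 0` the whole decomposition group fixes `K_∞` -/

namespace Literature.NumberTheory.EllipticCurves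

namespace ZpExtension

variable {K : Type u} [Field K] [NumberField K] {p : ℕ} [Fact p.Prime]

/-- **`κ(Γ_{K_w}) = 1` when `κ(φ_w) = 1`** for a `ℤ_p`-extension `κ` of `K`, a finite place `w ∤ p`
and an arithmetic Frobenius lift `φ_w ∈ Γ_{K_w}` (pushed into `Γ_K` along the decomposition map
`localMap K (Sum.inl w)`): the place is totally split in `K_∞/K`.
[cite: Washington1997, Prop. 13.2] [cite: Brink2007, Thm. 2 (prime decomposition in the anticyclotomic extension)] -/
theorem apply_localMap_inl_eq_one_of_isFrobPow (κ : ZpExtension K p) {w : HeightOneSpectrum (𝓞 K)}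
    (hw : ((p : ℕ) : 𝓞 K) ∉ w.asIdeal) {φ : absoluteGaloisGroup (w.adicCompletion K)}
    (hφ : IsFrobPow φ 1) (hκφ : κ (localMap K (Sum.inl w) φ) = 1)
    (δ : absoluteGaloisGroup (w.adicCompletion K)) : κ (localMap K (Sum.inl w) δ) = 1 :=
  ContinuousMonoidHom.padicInt_apply_eq_one_of_isFrobPow (w.ringChar_residueField_adicCompletion_ne hw)
    (κ.toContinuousMonoidHom.comp (localMap K (Sum.inl w))) hφ hκφ δ

/-- **Euler datum with `c = 0` ⟹ totally split**: if `(Nw, t, 0)` is the Euler datum of `W/K` at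
`w ∤ p` for `κ` (`JetchevSkinnerWan2017.IsEulerDataAt`, stated for `K : Type`), then
`κ ∘ localMap K (Sum.inl w) = 1`.
[cite: JetchevSkinnerWan2017, §5.1 Remark (`Ψ(Frob_w) = 1` at an inert `w`)] [cite: PollackWeston2011, Lemma 3.2] -/
theorem apply_localMap_inl_eq_one_of_isEulerDataAt {K : Type} [Field K] [NumberField K]
    {W : WeierstrassCurve K} (κ : ZpExtension K p)
    {w : HeightOneSpectrum (𝓞 K)} (hw : ((p : ℕ) : 𝓞 K) ∉ w.asIdeal) {Nw : ℕ} {t : LocalReductionData}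
    (h : JetchevSkinnerWan2017.IsEulerDataAt W κ w Nw t 0)
    (δ : absoluteGaloisGroup (w.adicCompletion K)) : κ (localMap K (Sum.inl w) δ) = 1 := by
  obtain ⟨-, ⟨φ, hφ, hκφ⟩, -⟩ := h
  exact apply_localMap_inl_eq_one_of_isFrobPow κ hw hφ (by rw [hκφ, ofAdd_zero]) δ

end ZpExtension

/-! ## §3 The local term at a totally split place, modulo the order of `H¹(K_w, E[p^∞])` -/

namespace JetchevSkinnerWan2017

variable {K : Type} [Field K] [NumberField K]

/-- **The local term of the `Σ`-change at a totally split place, reduced to `#H¹(K_w, E[p^∞])`.**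
For `W/K`, a prime `p`, a `ℤ_p`-extension `κ`, a finite place `w ∤ p` with Euler datum `(Nw, t, 0)`
(Frobenius exponent `c = 0`: `w` totally split in `K_∞`), and any topology on `Λ` making the action
continuous: if `H¹(K_w, E[p^∞])` (continuous `H¹` of `Γ_{K_w}` in `E[p^∞]` along the decomposition
map) is finite, then the Pontryagin dual of `H¹(K_w, T_pE ⊗ Λ^*(Ψ⁻¹))` is a finitely generated torsion
`Λ`-module whose characteristic ideal contains `#H¹(K_w, E[p^∞])` — the three conjuncts of
`sigmaLocal_charIdeal_eulerFactor_mem_of_noTamagawaDefect` at `w` with `#H¹(K_w, E[p^∞])` in place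
of `P_w` (`ZpExtension.apply_localMap_inl_eq_one_of_isEulerDataAt`, `bigRep_restrict`, module L2
`BigRepModule.moduleFinite_isTorsion_natCard_mem_charIdeal_h1_bigRep`).
[cite: PollackWeston2011, Lemma 3.2 ("`ℋ_ℓ = H¹(K_ℓ, A_f) ⊗ Λ^∨`")]
[cite: Castella2018, Thm. 2.3 (2.7) (the factor `∏_{w∈Σ} #H¹(K_w, E[p^∞])`) and Prop. 2.5] -/
theorem moduleFinite_isTorsion_natCard_mem_charIdeal_of_isEulerDataAt_zero
    (W : WeierstrassCurve K) (p : ℕ) [Fact p.Prime] (κ : ZpExtension K p)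
    (w : HeightOneSpectrum (𝓞 K)) (hw : ((p : ℕ) : 𝓞 K) ∉ w.asIdeal) (Nw : ℕ) (t : LocalReductionData)
    (hdata : IsEulerDataAt W κ w Nw t 0)
    [TopologicalSpace (IwasawaAlgebra p)]
    [ContinuousSMul (IwasawaAlgebra p) (BigRepModule ℤ_[p] p (PrimaryTorsion (geomPoints W) p))]
    [ContinuousSMul ℤ_[p] (PrimaryTorsion (geomPoints W) p)]
    [Finite (continuousCohomology 1
      ((W.primaryTorsionGaloisRep p).restrict (localMap K (Sum.inl w))).toTopRep)] :
    Module.Finite (IwasawaAlgebra p) (CharacterModule (continuousCohomology 1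
        ((AnticyclotomicBigGaloisRep κ (W.primaryTorsionGaloisRep p)).restrict
          (localMap K (Sum.inl w))).toTopRep)) ∧
      Module.IsTorsion (IwasawaAlgebra p) (CharacterModule (continuousCohomology 1
        ((AnticyclotomicBigGaloisRep κ (W.primaryTorsionGaloisRep p)).restrict
          (localMap K (Sum.inl w))).toTopRep)) ∧
        ((Nat.card (continuousCohomology 1
            ((W.primaryTorsionGaloisRep p).restrict (localMap K (Sum.inl w))).toTopRep) : ℕ) :
              IwasawaAlgebra p) ∈
          Module.charIdeal (IwasawaAlgebra p) (CharacterModule (continuousCohomology 1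
            ((AnticyclotomicBigGaloisRep κ (W.primaryTorsionGaloisRep p)).restrict
              (localMap K (Sum.inl w))).toTopRep)) := by
  haveI : CompactSpace (LocalGroup K (Sum.inl w)) := absoluteGaloisGroup_compactSpace (w.adicCompletion K)
  have hκ : ∀ δ : LocalGroup K (Sum.inl w),
      (κ.toContinuousMonoidHom.comp (localMap K (Sum.inl w))) δ = 1 :=
    ZpExtension.apply_localMap_inl_eq_one_of_isEulerDataAt κ hw hdata
  have hA : ∀ a : PrimaryTorsion (geomPoints W) p, ∃ k : ℕ, p ^ k • a = 0 := fun a ↦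
    (a.exists_pow_smul_eq_zero).imp fun k hk ↦
      PrimaryTorsion.ext (by rw [PrimaryTorsion.val_nsmul, hk, PrimaryTorsion.val_zero])
  have key := BigRepModule.moduleFinite_isTorsion_natCard_mem_charIdeal_h1_bigRep
    (κ.toContinuousMonoidHom.comp (localMap K (Sum.inl w)))
    ((W.primaryTorsionGaloisRep p).restrict (localMap K (Sum.inl w))) hκ hA
  rw [show (AnticyclotomicBigGaloisRep κ (W.primaryTorsionGaloisRep p)).restrict (localMap K (Sum.inl w)) =
      bigRep (κ.toContinuousMonoidHom.comp (localMap K (Sum.inl w)))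
        ((W.primaryTorsionGaloisRep p).restrict (localMap K (Sum.inl w))) from
    bigRep_restrict _ _ _]
  exact key

end JetchevSkinnerWan2017

end Literature.NumberTheory.EllipticCurves

end
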